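import Summits.QuantumFields.BalabanUV.T4Continuum.Support.NE7ConstrainedGreenOnCarrier
import Summits.QuantumFields.BalabanUV.T4Continuum.Support.NE7HessAntisymmetricPart
import HarnessLib

/-!
# NE7ConstrainedGreenSymmetricCarrier — (KL-B) IN SOURCE FORM FROM LETTERS ABOUT PRINT's **SYMMETRIC** SOFT OPERATOR `softSymOpK = HessSym_W + D_W R(W) D_W* + M⁻²Qbar*Qbar`
# ([B9] (3.26) `Δ_a(U)` SHAPE EXACTLY): the antisymmetric part of the tree's mixed Hessian is a first variation (F195), i.e. a SOURCE SHIFT bounded by `τ_W‖X″‖_∞‖·‖₁`, which the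
# VALUE row of the constrained propagator absorbs by a one-line bootstrap under `2·card n·τ_W·K₀ ≤ 1`; so F173's `hSrc` follows from: left inverses of `softSymOpK` and of
# `Qbar G Qbar*` ([B9] Thm 3.11 TYPE) + the sup-VALUE and sup-CURL rows of `C = G − GQbar*(QbarGQbar*)⁻¹QbarG` ([B9] Thm 3.3 (3.42) entries `|GJ|`, `|∇_U GJ|` + (3.49) TYPE),
# with constant `2K` (file 125 of the curved (APE), F196)

Cell `pub-balaban`, rung (B)+1 sub-cell t4, lineage `b2b-balaban-t4-ne7-p1` (CRUX PROVER NE7 #1 = OWNER of row NE7), generation 85; memo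
`t4/b2b-balaban-t4-ne7-p1-g85/LAGRANGE-CARRIER.md` §6.  Over F193 `NE7ConstrainedGreenOnCarrier` (slice ∕ gauge on the carrier), F192 `NE7BalabanSoftOperator` (`hessSymOpK`,
`softSymOpK_apply`), F191 `NE7SliceLagrangeMultiplier.sliceEq_lagrangeForm`, F195 `NE7HessAntisymmetricPart.abs_hess_sub_hessSym_le`, lineage #2's
`NE7FlatSliceSourceDuality.exists_skewSource_of_l1DualBound`, F166 `NE7ConstrainedGreenBalabanGauge.eq_source_of_gaugeFixed` BY NAME.
WHY.  F193∕F194 state the END's letters for the Riesz operator of the tree's MIXED Hessian `hess W X Y = ∂_s∂_t A(We^{sX}e^{tY})`; print's `Δ(U)` ([B9] (3.4)∕(3.9)) is the operator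
of the QUADRATIC form, i.e. of `hessSym`.  By F195, `hess(X″,Y) = hessSym(X″,Y) + ½dAction_W[X″,Y]` and `|½dAction_W[X″,Y]| ≤ τ_W‖X″‖_∞‖Y‖₁` (tension letter); lineage #2's
duality turns the shift into a skew periodic source `H_a`, `‖H_a‖_∞ ≤ card n·τ_W·‖X″‖_∞`; so `X″ = C_sym(H + H_a)` and the VALUE row gives `‖X″‖_∞ ≤ K₀(g + card n·τ_W‖X″‖_∞)`,
hence `‖X″‖_∞ ≤ 2K₀g` when `2·card n·τ_W·K₀ ≤ 1` (class-small: `τ_W ≍ c∕M³`, `K₀ ≍ M²`), and the CURL row gives `‖curl_W X″‖ ≤ K(1 + 2card n·τ_WK₀)g ≤ 2Kg`.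
WHAT ([folklore]; 0 def, 0 sorry).  §1 `srcPair_add_left`; `hessSymOpK_eq_of_lagrangeForm` (the symmetric Lagrange form in operator language); §2 `exists_antisymmetricSource`
(the source `H_a` of the shift `Y ↦ hessSym(X″,Y) − hess(X″,Y)` on the skew periodic fields); §3 **`resF_eq_constrainedGreen_symm`** (`resF X″ = C_sym(resF(H + H_a))`);
§4 **`sourceLetter_of_symmetric_rows`** — F173's `hSrc` at `Gauge := IsLandauB8` with constant `2K` from: the tension letter `τ`, left inverses `G`∕`Dinv` for `softSymOpK`, the value row
`K₀` and the curl row `K` of `constrainedGreen G Qbar Qbar* Dinv`, and `2·card n·τ·K₀ ≤ 1` (no sign hypothesis on `K₀` is needed: the bootstrap is inconsistent otherwise).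
HONEST FRAMING (page 1): finite-dimensional linear algebra + one bootstrap inequality; NO estimate of Bałaban's; all rows are DISPLAYED HYPOTHESES about concrete operators (their
identification with print's `Δ_a(U)`, `G(U)`, `(QGQ*)⁻¹` through lit-balaban's junction modules is NOT made here); (KL-B) at curved `W` NOT proved; (APE) on curved data NOT proved;
NOT ONE-STEP, NOT NE7; spine 0∕9; finite T⁴ rung (B)+1 — NOT infinite volume, NOT mass gap, NOT `BetaPertH`, NOT Clay.  Continuum YM on T⁴ ⇐ BetaPertH ∧ nine spine estimates
(0/9 proved); BetaPertH ⇐ (D1) ∧ (D4) ∧ CAP+tail; G-an2-4 gates asym, D1 and NE2/3/4.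
-/

set_option autoImplicit false

open scoped BigOperators InnerProductSpace Matrix Matrix.Norms.L2Operator
open Finset

namespace Summit.QuantumFields.BalabanUV.T4Continuum.NE7ConstrainedGreenSymmetricCarrier

open Literature.MathematicalPhysics.QuantumFieldTheory.Balaban1983to89
open B7Prop1Explicit B7Prop2Explicit UnitaryModel
open T4AveragingDeficitWall (IsUnitaryCfg IsSkewDir SmallField curlAt dirL1)
open T4AveragingDeficitWallBoundary (periodBox IsPeriodicCfg)
open AveragingDeficitPeriodicCounting (IsPeriodicDir)
open AveragingDeficitMultiLevelPrep (LevelSmall)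
open AveragingDeficitTorusChart (redN)
open MinimalActionLevels (perWin)
open NE3HessForm (hess dAction)
open NE3EnergyHessBilin (hessBilin hessBilin_apply hessSym hessSym_apply)
open NE3TangentCovariantTower (QbarIter)
open NE3CovariantCalculus (hsR hsR_add_left)
open NE3HilbertSchmidtTorus
open NE3.PairLandauB8 (IsLandauB8)
open NE7FlatSliceSourceDuality (srcPair periodic_eq_boxVec_redN exists_skewSource_of_l1DualBound)
open NE7SliceLagrangeMultiplier (sliceEq_lagrangeForm)
open NE7ConstrainedGreenIdentity (constrainedGreen)
open NE7ConstrainedGreenBalabanGauge (eq_source_of_gaugeFixed)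
open NE7BalabanSoftOperator
open NE7ConstrainedGreenOnCarrier (qbarOpK_eq_zero_iff landauProj_adjoint_grad_eq_zero_iff)
open NE7HessAntisymmetricPart (abs_hess_sub_hessSym_le)
open NE3CovariantLineSumsTower (QbarIter_add)
open NE3SmoothRightInverseW (QbarIter_smul)

noncomputable section

variable {d : ℕ} {n : Type*} [Fintype n] [DecidableEq n]

/-! ## §1 The symmetric Lagrange form in operator language -/

/-- The source pairing is additive in the source. [folklore] -/
theorem srcPair_add_left (H H' Y : Site d → Fin d → Matrix n n ℂ) (B : Finset (Site d)) :
    srcPair (fun y κ => H y κ + H' y κ) Y B = srcPair H Y B + srcPair H' Y B := by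
  simp only [srcPair, hsR_add_left, Finset.sum_add_distrib]

section Carrier

variable [Nonempty n] {L N : ℕ} [NeZero N] (hL : 1 ≤ L) (j : ℕ) [NeZero (N * L ^ (j + 1))]
  {W : Site d → Fin d → (Matrix n n ℂ)ˣ} {x : ℝ} (hWu : IsUnitaryCfg W) (hWP : IsPeriodicCfg W ((N * L ^ (j + 1) : ℕ) : ℤ))
  (hx : 0 ≤ x) (hs : LevelSmall d L j x) (hWx : SmallField W x)

/-- **`HessSym_W b = h + Qbar* m`** from the symmetric Lagrange form: if `hessSym W (extF b) Y = ⟨extF h, Y⟩ + ⟨extF m, QbarIter L (j+1) W Y⟩_{periodBox N}` for every skew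
`(N·L^{j+1})`-periodic `Y`, then `hessSymOpK b = h + Qbar* m`. [folklore] -/
theorem hessSymOpK_eq_of_lagrangeForm (b h : skewForms d n (N * L ^ (j + 1))) (m : skewForms d n N)
    (hlag : ∀ Y : Site d → Fin d → Matrix n n ℂ, IsSkewDir Y → IsPeriodicDir Y ((N * L ^ (j + 1) : ℕ) : ℤ) →
      hessSym W (perWin d (N * L ^ (j + 1))) (extF (N * L ^ (j + 1)) (b : Form d n (N * L ^ (j + 1)))) Y
        = srcPair (extF (N * L ^ (j + 1)) (h : Form d n (N * L ^ (j + 1)))) Y (periodBox (d := d) (N * L ^ (j + 1)))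
          + srcPair (extF N (m : Form d n N)) (QbarIter L (j + 1) W Y) (periodBox (d := d) N)) :
    hessSymOpK W (N * L ^ (j + 1)) b
      = h + (LinearMap.adjoint (𝕜 := ℝ) (E := skewForms d n (N * L ^ (j + 1))) (F := skewForms d n N) (qbarOpK (N := N) hL j hWu hx hs hWx)
              : skewForms d n N →ₗ[ℝ] skewForms d n (N * L ^ (j + 1))) m := by
  refine ext_inner_right ℝ fun c => ?_
  rw [inner_hessSymOpK_left, ← hessSym_apply, inner_add_left, LinearMap.adjoint_inner_left, hlag _ c.2 (isPeriodicDir_extF _ _), Submodule.coe_inner, Submodule.coe_inner,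
    inner_eq_sum_extF, coe_qbarOpK]
  congr 1
  conv_rhs => rw [← resF_extF N (m : Form d n N)]
  rw [inner_resF]
  rfl

/-! ## §2 The antisymmetric shift as a skew periodic source -/

omit [Nonempty n] [NeZero N] in
/-- **THE SHIFT SOURCE `H_a`.**  Under the tension letter `|dAction W K| ≤ τ‖K‖₁` (skew `(N·L^{j+1})`-periodic `K`), for a skew periodic `X″` with `‖X″‖_∞ ≤ s` there is a skew periodic
source `H_a` with `‖H_a y κ‖ ≤ card n·(τ·s)` representing the shift: `hessSym W X″ Y = hess W X″ Y + ⟨H_a, Y⟩` for every skew periodic `Y` (F195 + lineage #2's duality). [folklore] -/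
theorem exists_antisymmetricSource {τ : ℝ} (hτ : 0 ≤ τ)
    (hten : ∀ K : Site d → Fin d → Matrix n n ℂ, IsSkewDir K → IsPeriodicDir K ((N * L ^ (j + 1) : ℕ) : ℤ) →
      |dAction W K (perWin d (N * L ^ (j + 1)))| ≤ τ * dirL1 K (periodBox (d := d) (N * L ^ (j + 1))))
    {X'' : Site d → Fin d → Matrix n n ℂ} (hXs : IsSkewDir X'') (hXP : IsPeriodicDir X'' ((N * L ^ (j + 1) : ℕ) : ℤ))
    {s : ℝ} (hs0 : 0 ≤ s) (hXsup : ∀ (y : Site d) (κ : Fin d), ‖X'' y κ‖ ≤ s) :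
    ∃ Ha : Site d → Fin d → Matrix n n ℂ, IsSkewDir Ha ∧ IsPeriodicDir Ha ((N * L ^ (j + 1) : ℕ) : ℤ) ∧
      (∀ (y : Site d) (κ : Fin d), ‖Ha y κ‖ ≤ Fintype.card n * (τ * s)) ∧
      ∀ Y : Site d → Fin d → Matrix n n ℂ, IsSkewDir Y → IsPeriodicDir Y ((N * L ^ (j + 1) : ℕ) : ℤ) →
        hessSym W (perWin d (N * L ^ (j + 1))) X'' Y = hess W X'' Y (perWin d (N * L ^ (j + 1))) + srcPair Ha Y (periodBox (d := d) (N * L ^ (j + 1))) := by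
  -- the skew periodic fields as a real subspace
  let S : Submodule ℝ (Site d → Fin d → Matrix n n ℂ) :=
    { carrier := {Y | IsSkewDir Y ∧ IsPeriodicDir Y ((N * L ^ (j + 1) : ℕ) : ℤ)}
      add_mem' := by
        rintro Y Z ⟨hYs, hYP⟩ ⟨hZs, hZP⟩
        refine ⟨fun y κ => (skewAdjoint (Matrix n n ℂ)).add_mem (hYs y κ) (hZs y κ), fun y κ μ => ?_⟩
        show Y (y + ((N * L ^ (j + 1) : ℕ) : ℤ) • e κ) μ + Z (y + ((N * L ^ (j + 1) : ℕ) : ℤ) • e κ) μ = Y y μ + Z y μ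
        rw [hYP, hZP]
      zero_mem' := ⟨fun y κ => (skewAdjoint (Matrix n n ℂ)).zero_mem, fun y κ μ => rfl⟩
      smul_mem' := by
        rintro c Y ⟨hYs, hYP⟩
        refine ⟨fun y κ => skewAdjoint.smul_mem c (hYs y κ), fun y κ μ => ?_⟩
        show c • Y (y + ((N * L ^ (j + 1) : ℕ) : ℤ) • e κ) μ = c • Y y μ
        rw [hYP] }
  -- the shift functional `Y ↦ hessSym(X″,Y) − hess(X″,Y)` and its bound
  let φ : (Site d → Fin d → Matrix n n ℂ) →ₗ[ℝ] ℝ := hessSym W (perWin d (N * L ^ (j + 1))) X'' - hessBilin W (perWin d (N * L ^ (j + 1))) X''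
  have hφ : ∀ Y, φ Y = hessSym W (perWin d (N * L ^ (j + 1))) X'' Y - hess W X'' Y (perWin d (N * L ^ (j + 1))) := fun Y => by
    simp only [φ, LinearMap.sub_apply, hessBilin_apply]
  have hbound : ∀ Y ∈ S, |φ Y| ≤ τ * s * dirL1 Y (periodBox (d := d) (N * L ^ (j + 1))) := by
    rintro Y ⟨hYs, hYP⟩
    rw [hφ, abs_sub_comm]
    exact abs_hess_sub_hessSym_le W _ _ hτ hten hXs hXP hYs hYP hXsup
  obtain ⟨Ha, hHas, hHaP, hHab, hrep⟩ := exists_skewSource_of_l1DualBound (N * L ^ (j + 1)) S (fun Y hY => hY.1) (fun Y hY => hY.2) φ (by positivity) hbound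
  refine ⟨Ha, hHas, hHaP, hHab, fun Y hYs hYP => ?_⟩
  have h := hrep Y ⟨hYs, hYP⟩
  rw [hφ] at h
  linarith

/-! ## §3 The gauge-fixed slice solution is `C_sym(H + H_a)` -/

include hWP in
/-- **F166 ON THE CARRIER, SYMMETRIC CONVENTION.**  `X″` skew periodic on Bałaban's slice in the (1.38) gauge solving `hess W X″ Y = ⟨H, Y⟩` on the straight-tangent tests, `H_a` the
shift source of §2: for every left inverse `G` of `softSymOpK` and `Dinv` of `Qbar G Qbar*`, `resF X″ = constrainedGreen G Qbar Qbar* Dinv (resF (H + H_a))`. [folklore] -/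
theorem resF_eq_constrainedGreen_symm
    (G : skewForms d n (N * L ^ (j + 1)) →ₗ[ℝ] skewForms d n (N * L ^ (j + 1))) (hGS : ∀ y, G (softSymOpK hL j hWu hx hs hWx y) = y)
    (Dinv : skewForms d n N →ₗ[ℝ] skewForms d n N)
    (hD' : ∀ f, Dinv (qbarOpK (N := N) hL j hWu hx hs hWx (G
      ((LinearMap.adjoint (𝕜 := ℝ) (E := skewForms d n (N * L ^ (j + 1))) (F := skewForms d n N) (qbarOpK (N := N) hL j hWu hx hs hWx)
          : skewForms d n N →ₗ[ℝ] skewForms d n (N * L ^ (j + 1))) f))) = f)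
    {X'' H Ha : Site d → Fin d → Matrix n n ℂ} (hXs : IsSkewDir X'') (hXP : IsPeriodicDir X'' ((N * L ^ (j + 1) : ℕ) : ℤ))
    (hXQ : QbarIter L (j + 1) W X'' = 0) (hXG : IsLandauB8 (d := d) L N (j + 1) W X'')
    (hHP : IsPeriodicDir H ((N * L ^ (j + 1) : ℕ) : ℤ)) (hHaP : IsPeriodicDir Ha ((N * L ^ (j + 1) : ℕ) : ℤ))
    (heq : ∀ Y : Site d → Fin d → Matrix n n ℂ, IsSkewDir Y → IsPeriodicDir Y ((N * L ^ (j + 1) : ℕ) : ℤ) → QbarIter L (j + 1) W Y = 0 →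
      hess W X'' Y (perWin d (N * L ^ (j + 1))) = srcPair H Y (periodBox (d := d) (N * L ^ (j + 1))))
    (hshift : ∀ Y : Site d → Fin d → Matrix n n ℂ, IsSkewDir Y → IsPeriodicDir Y ((N * L ^ (j + 1) : ℕ) : ℤ) →
      hessSym W (perWin d (N * L ^ (j + 1))) X'' Y = hess W X'' Y (perWin d (N * L ^ (j + 1))) + srcPair Ha Y (periodBox (d := d) (N * L ^ (j + 1))))
    (hsum : IsSkewDir (fun y κ => H y κ + Ha y κ)) :
    (⟨resF (N * L ^ (j + 1)) X'', resF_mem_skewForms hXs⟩ : skewForms d n (N * L ^ (j + 1)))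
      = constrainedGreen G (qbarOpK (N := N) hL j hWu hx hs hWx)
          (LinearMap.adjoint (𝕜 := ℝ) (E := skewForms d n (N * L ^ (j + 1))) (F := skewForms d n N) (qbarOpK (N := N) hL j hWu hx hs hWx)
              : skewForms d n N →ₗ[ℝ] skewForms d n (N * L ^ (j + 1)))
          Dinv ⟨resF (N * L ^ (j + 1)) (fun y κ => H y κ + Ha y κ), resF_mem_skewForms hsum⟩ := by
  -- the multiplier of the mixed equation (F191)
  obtain ⟨μ, hμs, hμP, hμ⟩ := sliceEq_lagrangeForm hL j hWu hWP hx hs hWx (X'' := X'') (H := H) heq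
  have hsumP : IsPeriodicDir (fun y κ => H y κ + Ha y κ) ((N * L ^ (j + 1) : ℕ) : ℤ) := fun y κ μ' => by
    show H (y + ((N * L ^ (j + 1) : ℕ) : ℤ) • e κ) μ' + Ha (y + ((N * L ^ (j + 1) : ℕ) : ℤ) • e κ) μ' = H y μ' + Ha y μ'
    rw [hHP, hHaP]
  set b : skewForms d n (N * L ^ (j + 1)) := ⟨resF (N * L ^ (j + 1)) X'', resF_mem_skewForms hXs⟩ with hb
  set h' : skewForms d n (N * L ^ (j + 1)) := ⟨resF (N * L ^ (j + 1)) (fun y κ => H y κ + Ha y κ), resF_mem_skewForms hsum⟩ with hh'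
  set m : skewForms d n N := ⟨resF N μ, resF_mem_skewForms hμs⟩ with hm
  have hbX : extF (N * L ^ (j + 1)) (b : Form d n (N * L ^ (j + 1))) = X'' := extF_resF _ hXP
  have hhH : extF (N * L ^ (j + 1)) (h' : Form d n (N * L ^ (j + 1))) = fun y κ => H y κ + Ha y κ := extF_resF _ hsumP
  have hmμ : extF N (m : Form d n N) = μ := extF_resF _ hμP
  -- the symmetric Lagrange form
  have hsrc := hessSymOpK_eq_of_lagrangeForm hL j hWu hx hs hWx b h' m (fun Y hYs hYP => by
    rw [hbX, hhH, hmμ, hshift Y hYs hYP, hμ Y hYs hYP, srcPair_add_left]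
    ring)
  have hxQ : qbarOpK (N := N) hL j hWu hx hs hWx b = 0 := by rw [qbarOpK_eq_zero_iff hL j hWu hWP hx hs hWx, hbX]; exact hXQ
  have hgauge := (landauProj_adjoint_grad_eq_zero_iff j hWu hWP b).mpr (by rw [hbX]; exact hXG)
  exact eq_source_of_gaugeFixed (softSymOpK hL j hWu hx hs hWx) (hessSymOpK W (N * L ^ (j + 1))) G (qbarOpK (N := N) hL j hWu hx hs hWx)
    (LinearMap.adjoint (𝕜 := ℝ) (E := skewForms d n (N * L ^ (j + 1))) (F := skewForms d n N) (qbarOpK (N := N) hL j hWu hx hs hWx))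
    ((((L : ℝ) ^ (j + 1)) ^ 2)⁻¹ • LinearMap.id) Dinv (gradOpK hWu (N * L ^ (j + 1))) (landauProjK L N (j + 1) W)
    (LinearMap.adjoint (𝕜 := ℝ) (E := skewSecs d n (N * L ^ (j + 1))) (F := skewForms d n (N * L ^ (j + 1))) (gradOpK hWu (N * L ^ (j + 1))))
    (softSymOpK_apply hL j hWu hx hs hWx) hGS hD' hxQ hgauge hsrc

/-! ## §4 The SOURCE form of (KL-B) from the symmetric operator's rows, by bootstrap -/

include hWP in
/-- **(KL-B) IN SOURCE FORM FROM [B9] Thm 3.11 + Thm 3.3∕(3.49) TYPE LETTERS ABOUT THE SYMMETRIC `softSymOpK`.**  HYPOTHESES (displayed, NOT proved): the tension letter `τ`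
(discharged in the class by `NE7TensionRadiusOfFluxGradient`); a left inverse `G` of `softSymOpK` and `Dinv` of `Qbar G Qbar*` (EXISTENCE = positivity, Thm 3.11 TYPE); the sup-VALUE
row `K₀` and the sup-CURL row `K` of `C = constrainedGreen G Qbar Qbar* Dinv` (Thm 3.3 entries `|GJ|`, `|∇_UGJ|` + (3.49) TYPE); the class-smallness `2·card n·τ·K₀ ≤ 1`.
CONCLUSION: F173's `hSrc` at `Gauge := IsLandauB8 L N (j+1) W` with constant `2K`. [folklore] -/
theorem sourceLetter_of_symmetric_rows {τ : ℝ} (hτ : 0 ≤ τ)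
    (hten : ∀ K : Site d → Fin d → Matrix n n ℂ, IsSkewDir K → IsPeriodicDir K ((N * L ^ (j + 1) : ℕ) : ℤ) →
      |dAction W K (perWin d (N * L ^ (j + 1)))| ≤ τ * dirL1 K (periodBox (d := d) (N * L ^ (j + 1))))
    (G : skewForms d n (N * L ^ (j + 1)) →ₗ[ℝ] skewForms d n (N * L ^ (j + 1))) (hGS : ∀ y, G (softSymOpK hL j hWu hx hs hWx y) = y)
    (Dinv : skewForms d n N →ₗ[ℝ] skewForms d n N)
    (hD' : ∀ f, Dinv (qbarOpK (N := N) hL j hWu hx hs hWx (G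
      ((LinearMap.adjoint (𝕜 := ℝ) (E := skewForms d n (N * L ^ (j + 1))) (F := skewForms d n N) (qbarOpK (N := N) hL j hWu hx hs hWx)
          : skewForms d n N →ₗ[ℝ] skewForms d n (N * L ^ (j + 1))) f))) = f)
    {K₀ K : ℝ} (hK : 0 ≤ K)
    (hC0 : ∀ h : skewForms d n (N * L ^ (j + 1)), ∀ g : ℝ, (∀ (y : Site d) (κ : Fin d), ‖extF (N * L ^ (j + 1)) (h : Form d n (N * L ^ (j + 1))) y κ‖ ≤ g) →
      ∀ (y : Site d) (κ : Fin d),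
        ‖extF (N * L ^ (j + 1)) ((constrainedGreen G (qbarOpK (N := N) hL j hWu hx hs hWx)
            (LinearMap.adjoint (𝕜 := ℝ) (E := skewForms d n (N * L ^ (j + 1))) (F := skewForms d n N) (qbarOpK (N := N) hL j hWu hx hs hWx)
                : skewForms d n N →ₗ[ℝ] skewForms d n (N * L ^ (j + 1)))
            Dinv h : skewForms d n (N * L ^ (j + 1))) : Form d n (N * L ^ (j + 1))) y κ‖ ≤ K₀ * g)
    (hC1 : ∀ h : skewForms d n (N * L ^ (j + 1)), ∀ g : ℝ, (∀ (y : Site d) (κ : Fin d), ‖extF (N * L ^ (j + 1)) (h : Form d n (N * L ^ (j + 1))) y κ‖ ≤ g) →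
      ∀ (z : Site d) (μ' ν' : Fin d), μ' ≠ ν' →
        ‖curlAt W (extF (N * L ^ (j + 1)) ((constrainedGreen G (qbarOpK (N := N) hL j hWu hx hs hWx)
            (LinearMap.adjoint (𝕜 := ℝ) (E := skewForms d n (N * L ^ (j + 1))) (F := skewForms d n N) (qbarOpK (N := N) hL j hWu hx hs hWx)
                : skewForms d n N →ₗ[ℝ] skewForms d n (N * L ^ (j + 1)))
            Dinv h : skewForms d n (N * L ^ (j + 1))) : Form d n (N * L ^ (j + 1)))) z μ' ν'‖ ≤ K * g)
    (hsmall : 2 * (Fintype.card n * τ) * K₀ ≤ 1) :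
    ∀ X'' : Site d → Fin d → Matrix n n ℂ, IsSkewDir X'' → IsPeriodicDir X'' ((N * L ^ (j + 1) : ℕ) : ℤ) → QbarIter L (j + 1) W X'' = 0 →
      IsLandauB8 (d := d) L N (j + 1) W X'' →
      ∀ H : Site d → Fin d → Matrix n n ℂ, IsSkewDir H → IsPeriodicDir H ((N * L ^ (j + 1) : ℕ) : ℤ) → ∀ g : ℝ, 0 ≤ g → (∀ (y : Site d) (κ : Fin d), ‖H y κ‖ ≤ g) →
      (∀ Y : Site d → Fin d → Matrix n n ℂ, IsSkewDir Y → IsPeriodicDir Y ((N * L ^ (j + 1) : ℕ) : ℤ) → QbarIter L (j + 1) W Y = 0 →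
        hess W X'' Y (perWin d (N * L ^ (j + 1))) = srcPair H Y (periodBox (d := d) (N * L ^ (j + 1)))) →
      ∀ (z : Site d) (μ' ν' : Fin d), μ' ≠ ν' → ‖curlAt W X'' z μ' ν'‖ ≤ (2 * K) * g := by
  intro X'' hXs hXP hXQ hXG H hHs hHP g hg hHb heq z μ' ν' hne
  -- the sup of `X″` over one period, attained
  obtain ⟨p₀, -, hp₀⟩ := Finset.exists_max_image (Finset.univ : Finset ((Fin d → Fin (N * L ^ (j + 1))) × Fin d))
    (fun p => ‖X'' (boxVec (N * L ^ (j + 1)) p.1) p.2‖) ⟨(fun _ => 0, μ'), Finset.mem_univ _⟩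
  set s : ℝ := ‖X'' (boxVec (N * L ^ (j + 1)) p₀.1) p₀.2‖ with hsdef
  have hs0 : 0 ≤ s := norm_nonneg _
  have hXsup : ∀ (y : Site d) (κ : Fin d), ‖X'' y κ‖ ≤ s := fun y κ => by
    rw [periodic_eq_boxVec_redN hXP y κ]
    exact hp₀ (redN (N * L ^ (j + 1)) y, κ) (Finset.mem_univ _)
  -- the shift source and the representation `X″ = C_sym(H + H_a)`
  obtain ⟨Ha, hHas, hHaP, hHab, hshift⟩ := exists_antisymmetricSource (N := N) (L := L) j (W := W) hτ hten hXs hXP hs0 hXsup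
  have hsum : IsSkewDir (fun y κ => H y κ + Ha y κ) := fun y κ => (skewAdjoint (Matrix n n ℂ)).add_mem (hHs y κ) (hHas y κ)
  have hsumP : IsPeriodicDir (fun y κ => H y κ + Ha y κ) ((N * L ^ (j + 1) : ℕ) : ℤ) := fun y κ μ'' => by
    show H (y + ((N * L ^ (j + 1) : ℕ) : ℤ) • e κ) μ'' + Ha (y + ((N * L ^ (j + 1) : ℕ) : ℤ) • e κ) μ'' = H y μ'' + Ha y μ''
    rw [hHP, hHaP]
  have hmain := resF_eq_constrainedGreen_symm hL j hWu hWP hx hs hWx G hGS Dinv hD' hXs hXP hXQ hXG hHP hHaP heq hshift hsum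
  set h' : skewForms d n (N * L ^ (j + 1)) := ⟨resF (N * L ^ (j + 1)) (fun y κ => H y κ + Ha y κ), resF_mem_skewForms hsum⟩ with hh'
  have hX : X'' = extF (N * L ^ (j + 1)) ((constrainedGreen G (qbarOpK (N := N) hL j hWu hx hs hWx)
            (LinearMap.adjoint (𝕜 := ℝ) (E := skewForms d n (N * L ^ (j + 1))) (F := skewForms d n N) (qbarOpK (N := N) hL j hWu hx hs hWx)
                : skewForms d n N →ₗ[ℝ] skewForms d n (N * L ^ (j + 1)))
            Dinv h' : skewForms d n (N * L ^ (j + 1))) : Form d n (N * L ^ (j + 1))) := by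
    rw [← hmain, Submodule.coe_mk, extF_resF _ hXP]
  -- the source size `g′ = g + card n·τ·s`
  have hg' : ∀ (y : Site d) (κ : Fin d), ‖extF (N * L ^ (j + 1)) (h' : Form d n (N * L ^ (j + 1))) y κ‖ ≤ g + Fintype.card n * (τ * s) := fun y κ => by
    rw [hh', Submodule.coe_mk, extF_resF _ hsumP]
    exact (norm_add_le _ _).trans (add_le_add (hHb y κ) (hHab y κ))
  -- bootstrap of the sup by the VALUE row
  have hsup : s ≤ K₀ * (g + Fintype.card n * (τ * s)) := by
    have h := hC0 h' _ hg' (boxVec (N * L ^ (j + 1)) p₀.1) p₀.2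
    rwa [← hX] at h
  have hs2 : s ≤ 2 * K₀ * g := by nlinarith [mul_nonneg (mul_nonneg (Nat.cast_nonneg (Fintype.card n)) hτ) hs0]
  -- the CURL row
  have hcurl := hC1 h' _ hg' z μ' ν' hne
  rw [← hX] at hcurl
  calc ‖curlAt W X'' z μ' ν'‖ ≤ K * (g + Fintype.card n * (τ * s)) := hcurl
    _ ≤ K * (g + Fintype.card n * (τ * (2 * K₀ * g))) := by gcongr
    _ = K * (1 + 2 * (Fintype.card n * τ) * K₀) * g := by ring
    _ ≤ K * (1 + 1) * g := by gcongr
    _ = (2 * K) * g := by ring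

end Carrier

end

end Summit.QuantumFields.BalabanUV.T4Continuum.NE7ConstrainedGreenSymmetricCarrier
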